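import Summits.QuantumFields.YangMills.Theorems.UnitScaleTiltCoverSitesPush
import Literature.MathematicalPhysics.QuantumFieldTheory.Balaban1983to89.B3TorusRadialSums
import Mathlib.Analysis.SpecificLimits.Basic
import HarnessLib

/-!
# Route `UnitScaleTilt`, crux K1 «MinimiserStabilityRegPr» (stmt-QuantumFields-19200), EX face S41ᴸ ✓p729078 — the thirteen [B9] §3 print rows at the
# members BELOW the suppliers' volume rider (desk `DELIVERY-SHAPES-I06-g38.md` §4 note 3; px12 g10 LOCATE ca491b4c road (R2) «COVER DESCENT»), brick
# **KERNEL ROWS DESCEND ALONG THE `L^{jc}`-FOLD COVER WITH NO LOSS OF RATE**: the fibre sum of an exponentially decaying `ℓ¹` torus kernel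

Cell `ym3-torus` (HUMAN RULING D-0037, YM ladder rung R3 — continuum SU(2) YM₃ on T³ is a RUNG: NOT d = 4, NOT infinite volume, NOT a mass gap, NOT the Clay
problem), width seat `ym3-torus-px4` gen 10.  THEOREMS ONLY (0 `def`, 0 `sorry`, default heartbeats); `--supports stmt-QuantumFields-19200 --as helper`;
count-neutral.  Nothing of the thirteen N06 rows, `hThm2S`, EX or the crux is claimed.

WHY.  Road (R2) of px12 g10's LOCATE transports the seven KERNEL rows of the EX face (`h133 h88 h137kπ h137kΔ hCk h349`, the column row `hPcol`) from a member
ABOVE the volume rider of the landed T³ suppliers (K1 ✓p644115 ∕ KH1 ✓p645309: `a′ + 3 ≤ F.m + n`) to the member itself along the covering map `π : Site (cover P jc) i →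
Site P i` of ✓`CoverSites`: a point source `single y Z` downstairs pulls back to the SUM of the point sources over the fibre `π⁻¹ y` (§4), so a kernel entry downstairs is
a FIBRE SUM (`CoverSites.push`) of kernel entries upstairs, and the estimate the road needs is `Σ_{ỹ ∈ π⁻¹ y} e^{−δ·|x̃ − ỹ|₁} ≤ c·e^{−δ·|π x̃ − y|₁}` with `c` uniform in
the member — print's «the constants … do not depend on the sequence {Ω_j}» ([Balaban1985BackgroundPropagators] p.399 L1–3) read on the cover, distance «|y − y′|» of
[Balaban1984PropagatorsI] (1.110) p.35.  Here `c = (2 ∕ (1 − e^{−δ·N_i}))^d ≤ (2 ∕ (1 − e^{−2δ}))^d` (`N_i = 2L^{m+K−i}`), with NO loss in the rate `δ`: `Site.tdist` is a sum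
over coordinates, the site fibre is the product of the coordinate fibres, and each coordinate fibre over `e ∈ ZMod N` is the `N`-spaced coset `{e.val + N·k : k < N′∕N}`,
whose two geometric tails start at `e.val ≥ cdist e` and `(−e).val ≥ cdist e`.  (Prior art: ✓`CoverLetters.sum_fibre_decay_le` ∕ `hDecayLetterD_of_cover` (★w4-19200 g3)
descend ROW-SUM letters of [B11] (161) by the fibre COUNT, constant `(L^{jc})^d`; this file is the pointwise-kernel shape with a `jc`-free constant.)

WHAT IS PROVED (namespace `…Theorems.CoverKernelFibreSum`; [folklore] finite sums on `(ℤ∕N′)^d → (ℤ∕N)^d`, `N ∣ N′`):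
* §1 one coordinate, general moduli `N ∣ N′`: `cdist_castHom_le` (reduction shrinks the circular distance), `fibre_eq_image` ∕ `val_fibreLift` ∕ `fibreLift_injective`
  (the fibre over `e` is `{e.val + N·k : k < N′∕N}`, listed once), `sum_fibre_eq_sum_fin`, ★`sum_fibre_exp_neg_val_le`
  (`Σ_{π s = e} e^{−δ·s.val} ≤ (1 − e^{−δN})⁻¹·e^{−δ·e.val}`), ★`sum_fibre_exp_neg_cdist_le` (`Σ_{π s = e} e^{−δ·cdist s} ≤ 2(1 − e^{−δN})⁻¹·e^{−δ·cdist e}`),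
  `sum_fibre_exp_neg_cdist_sub_le` (the same for `Σ_{π t = c} e^{−δ·cdist (a − t)}` against `cdist (π a − c)`).
* §2 sites of the cover: `tdist_proj_le` (`|π x̃ − π ỹ|₁ ≤ |x̃ − ỹ|₁`, the `ℓ¹` twin of ✓`CoverSites.distSite_proj_le`), `filter_proj_eq_piFinset` (the site fibre is the
  product of the coordinate fibres), ★★`sum_fibre_exp_neg_tdist_le`
  (`Σ_{π ỹ = y} e^{−δ·|x̃ − ỹ|₁} ≤ (2(1 − e^{−δ·N_i})⁻¹)^d · e^{−δ·|π x̃ − y|₁}`), `fibreConst_le`∕`fibreConst_nonneg` and ★★`sum_fibre_exp_neg_tdist_le'` (the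
  member-free constant `(2(1 − e^{−2δ})⁻¹)^d`).
* §3 kernels: ★★`norm_push_le_of_kernel_decay` — if `‖g ỹ‖ ≤ C·e^{−δ|x̃ − ỹ|₁}` on the cover then `‖(π_* g) y‖ ≤ C·(2(1 − e^{−2δ})⁻¹)^d·e^{−δ|π x̃ − y|₁}` downstairs
  (`CoverSites.push`), and the bond-indexed form `norm_pushBond_le_of_kernel_decay` (sources of bonds, direction carried along).
* §4 point sources: `single_comp_proj` ∕ `single_comp_projBond` — `(single y Z) ∘ π = Σ_{π ỹ = y} single ỹ Z` (the pullback of a point source is the fibre sum of point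
  sources), the identity that makes a downstairs kernel column the `push` of upstairs columns for any operator natural under the pullback.
HONEST SCOPE: finite-torus bookkeeping + one geometric series; no operators, no gauge fields; the naturality of the thirteen operators under the cover pullback (the
rest of road (R2)) is NOT touched here.  NOT a claim about the stub, the crux, the rung or a mass gap.

References: T. Bałaban, CMP **99** (1985) 389–434 [Balaban1985BackgroundPropagators] (Thm 3.1–3.3 pp.397–399, p.399 L1–3; (3.42) entry shape `e^{−δ₀|y−y′|}`);
CMP **95** (1984) 17–40 [Balaban1984PropagatorsI] ((1.109)–(1.110) p.35, the circular distance); CMP **109** (1987) 249–301 [Balaban1987RG1] ((0.1)–(0.3) pp.251–252,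
the tori `T^{(i)}` and their site counts `2L^{m+K−i}`).
-/

open scoped BigOperators

namespace Summit.QuantumFields.YangMills.Theorems.CoverKernelFibreSum

open Literature.MathematicalPhysics.QuantumFieldTheory.Balaban1983to89
open B3TorusRadialSums (cdist cdist_le_val cdist_le_neg_val tdist_eq_sum_cdist)
open Summit.QuantumFields.YangMills.Theorems.CoverSites

/-! ## §1 One coordinate: the fibre of the reduction `ZMod N′ → ZMod N` (`N ∣ N′`) over a residue, and its exponential sums -/

section OneCoordinate

variable {N N' : ℕ}

/-- **reduction shrinks the circular distance from `0`** (one coordinate of `|π x̃ − π ỹ|₁ ≤ |x̃ − ỹ|₁`): the canonical representatives of `π s` and `−π s = π(−s)`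
are the representatives of `s`, `−s` reduced `mod N`. [cite: Balaban1984PropagatorsI, (1.110) p.35] -/
theorem cdist_castHom_le [NeZero N'] (h : N ∣ N') (a : ZMod N') : cdist (ZMod.castHom h (ZMod N) a) ≤ cdist a := by
  have h1 : (ZMod.castHom h (ZMod N) a).val ≤ a.val := by
    rw [ZMod.castHom_apply, ZMod.cast_eq_val, ZMod.val_natCast]; exact Nat.mod_le _ _
  have h2 : (-(ZMod.castHom h (ZMod N) a)).val ≤ (-a).val := by
    rw [← map_neg, ZMod.castHom_apply, ZMod.cast_eq_val, ZMod.val_natCast]; exact Nat.mod_le _ _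
  dsimp only [cdist]
  exact min_le_min h1 h2

/-- the canonical representative of the `k`-th lift `e.val + N·k` (`k < N′∕N`) is itself. [folklore] -/
theorem val_fibreLift [NeZero N] [NeZero N'] (h : N ∣ N') (e : ZMod N) (k : Fin (N' / N)) : (((e.val + N * (k : ℕ) : ℕ) : ZMod N')).val = e.val + N * (k : ℕ) := by
  apply ZMod.val_natCast_of_lt
  have he := e.val_lt
  have hk := k.2
  calc e.val + N * (k : ℕ) < N + N * (k : ℕ) := by omega
    _ = N * ((k : ℕ) + 1) := by ring
    _ ≤ N * (N' / N) := Nat.mul_le_mul_left _ hk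
    _ = N' := Nat.mul_div_cancel' h

/-- the lifts `k ↦ e.val + N·k`, `k < N′∕N`, are pairwise distinct residues `mod N′`. [folklore] -/
theorem fibreLift_injective [NeZero N] [NeZero N'] (h : N ∣ N') (e : ZMod N) : Function.Injective fun k : Fin (N' / N) => ((e.val + N * (k : ℕ) : ℕ) : ZMod N') := by
  intro q q' hq
  have hN0 : 0 < N := Nat.pos_of_ne_zero (NeZero.ne N)
  have hv := congrArg ZMod.val hq
  dsimp only at hv
  rw [val_fibreLift h e q, val_fibreLift h e q'] at hv
  exact Fin.ext (Nat.eq_of_mul_eq_mul_left hN0 (by omega))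

/-- **THE FIBRE OVER A RESIDUE IS AN `N`-SPACED COSET**: `π⁻¹ e = {e.val + N·k : k < N′∕N}` in `ZMod N′`. [folklore] -/
theorem fibre_eq_image [NeZero N] [NeZero N'] (h : N ∣ N') (e : ZMod N) :
    (Finset.univ.filter fun s : ZMod N' => ZMod.castHom h (ZMod N) s = e) =
      (Finset.univ : Finset (Fin (N' / N))).image fun k : Fin (N' / N) => ((e.val + N * (k : ℕ) : ℕ) : ZMod N') := by
  have hN0 : 0 < N := Nat.pos_of_ne_zero (NeZero.ne N)
  ext a
  simp only [Finset.mem_filter, Finset.mem_univ, true_and, Finset.mem_image]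
  constructor
  · intro ha
    have hval : a.val % N = e.val := by
      have := congrArg ZMod.val ha
      rwa [ZMod.castHom_apply, ZMod.cast_eq_val, ZMod.val_natCast] at this
    have hq : a.val / N < N' / N := by
      rw [Nat.div_lt_iff_lt_mul hN0, Nat.div_mul_cancel h]
      exact a.val_lt
    refine ⟨⟨a.val / N, hq⟩, ?_⟩
    show ((e.val + N * (a.val / N) : ℕ) : ZMod N') = a
    rw [← hval, Nat.mod_add_div, ZMod.natCast_zmod_val]
  · rintro ⟨q, rfl⟩
    rw [map_natCast, Nat.cast_add, Nat.cast_mul, ZMod.natCast_self, zero_mul, add_zero, ZMod.natCast_zmod_val]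

/-- **sums over a fibre are sums over the lifts** `k < N′∕N`. [folklore] -/
theorem sum_fibre_eq_sum_fin [NeZero N] [NeZero N'] (h : N ∣ N') {M : Type*} [AddCommMonoid M] (e : ZMod N) (f : ZMod N' → M) :
    ∑ s ∈ Finset.univ.filter (fun s : ZMod N' => ZMod.castHom h (ZMod N) s = e), f s =
      ∑ k : Fin (N' / N), f (((e.val + N * (k : ℕ) : ℕ) : ZMod N')) := by
  rw [fibre_eq_image h e, Finset.sum_image fun q _ q' _ hq => fibreLift_injective h e hq]

/-- ★ **THE GEOMETRIC TAIL OF A FIBRE**: `Σ_{π s = e} e^{−δ·s.val} ≤ (1 − e^{−δN})⁻¹ · e^{−δ·e.val}` (the representatives of the fibre are `e.val + N·k`).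
[folklore] -/
theorem sum_fibre_exp_neg_val_le [NeZero N] [NeZero N'] (h : N ∣ N') {δ : ℝ} (hδ : 0 < δ) (e : ZMod N) :
    ∑ s ∈ Finset.univ.filter (fun s : ZMod N' => ZMod.castHom h (ZMod N) s = e), Real.exp (-(δ * (s.val : ℝ))) ≤
      (1 - Real.exp (-(δ * N)))⁻¹ * Real.exp (-(δ * (e.val : ℝ))) := by
  have hN1 : (1 : ℝ) ≤ N := by exact_mod_cast Nat.pos_of_ne_zero (NeZero.ne N)
  have hr0 : 0 ≤ Real.exp (-(δ * N)) := (Real.exp_pos _).le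
  have hr1 : Real.exp (-(δ * N)) < 1 := Real.exp_lt_one_iff.mpr (by nlinarith)
  rw [sum_fibre_eq_sum_fin h e]
  calc ∑ k : Fin (N' / N), Real.exp (-(δ * ((((e.val + N * (k : ℕ) : ℕ) : ZMod N')).val : ℝ)))
      = ∑ k : Fin (N' / N), Real.exp (-(δ * (e.val : ℝ))) * Real.exp (-(δ * N)) ^ (k : ℕ) := by
        refine Finset.sum_congr rfl fun k _ => ?_
        rw [val_fibreLift h e k, ← Real.exp_nat_mul, ← Real.exp_add]
        congr 1
        push_cast
        ring
    _ = Real.exp (-(δ * (e.val : ℝ))) * ∑ k ∈ Finset.range (N' / N), Real.exp (-(δ * N)) ^ k := by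
        rw [Finset.mul_sum, Fin.sum_univ_eq_sum_range (fun k => Real.exp (-(δ * (e.val : ℝ))) * Real.exp (-(δ * N)) ^ k)]
    _ ≤ Real.exp (-(δ * (e.val : ℝ))) * ∑' k, Real.exp (-(δ * N)) ^ k := by
        gcongr
        exact (summable_geometric_of_lt_one hr0 hr1).sum_le_tsum _ fun k _ => pow_nonneg hr0 k
    _ = (1 - Real.exp (-(δ * N)))⁻¹ * Real.exp (-(δ * (e.val : ℝ))) := by
        rw [tsum_geometric_of_lt_one hr0 hr1, mul_comm]

/-- negation maps the fibre over `e` onto the fibre over `−e` (a ring homomorphism commutes with `−`). [folklore] -/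
theorem sum_fibre_neg [NeZero N'] (h : N ∣ N') {M : Type*} [AddCommMonoid M] (e : ZMod N) (f : ZMod N' → M) :
    ∑ s ∈ Finset.univ.filter (fun s : ZMod N' => ZMod.castHom h (ZMod N) s = e), f (-s) =
      ∑ s ∈ Finset.univ.filter (fun s : ZMod N' => ZMod.castHom h (ZMod N) s = -e), f s := by
  refine Finset.sum_nbij' (fun s => -s) (fun s => -s) ?_ ?_ (fun a _ => neg_neg a) (fun a _ => neg_neg a) (fun a _ => rfl)
  · intro a ha
    simp only [Finset.mem_filter, Finset.mem_univ, true_and] at ha ⊢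
    rw [map_neg, ha]
  · intro a ha
    simp only [Finset.mem_filter, Finset.mem_univ, true_and] at ha ⊢
    rw [map_neg, ha, neg_neg]

/-- ★ **ONE COORDINATE OF THE BRICK**: `Σ_{π s = e} e^{−δ·cdist s} ≤ 2(1 − e^{−δN})⁻¹ · e^{−δ·cdist e}` — bound `e^{−δ·min(s.val, (−s).val)}` by the sum of the two
exponentials, sum each geometric tail over the coset (`sum_fibre_exp_neg_val_le` for `e` and, after `s ↦ −s`, for `−e`), and use `cdist e ≤ e.val`, `cdist e ≤ (−e).val`.
[cite: Balaban1984PropagatorsI, (1.110) p.35] -/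
theorem sum_fibre_exp_neg_cdist_le [NeZero N] [NeZero N'] (h : N ∣ N') {δ : ℝ} (hδ : 0 < δ) (e : ZMod N) :
    ∑ s ∈ Finset.univ.filter (fun s : ZMod N' => ZMod.castHom h (ZMod N) s = e), Real.exp (-(δ * (cdist s : ℝ))) ≤
      2 * (1 - Real.exp (-(δ * N)))⁻¹ * Real.exp (-(δ * (cdist e : ℝ))) := by
  -- pointwise `e^{−δ cdist s} ≤ e^{−δ s.val} + e^{−δ (−s).val}`; then the two tails
  have hpt : ∀ s : ZMod N', Real.exp (-(δ * (cdist s : ℝ))) ≤ Real.exp (-(δ * (s.val : ℝ))) + Real.exp (-(δ * ((-s).val : ℝ))) := fun s => by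
    dsimp only [cdist]; rcases min_choice s.val (-s).val with hm | hm
    · rw [hm]; exact le_add_of_nonneg_right (Real.exp_pos _).le
    · rw [hm]; exact le_add_of_nonneg_left (Real.exp_pos _).le
  have hA := sum_fibre_exp_neg_val_le h hδ e
  have hB : ∑ s ∈ Finset.univ.filter (fun s : ZMod N' => ZMod.castHom h (ZMod N) s = e), Real.exp (-(δ * ((-s).val : ℝ))) ≤
      (1 - Real.exp (-(δ * N)))⁻¹ * Real.exp (-(δ * ((-e).val : ℝ))) := by
    rw [sum_fibre_neg h e (fun s => Real.exp (-(δ * (s.val : ℝ))))]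
    exact sum_fibre_exp_neg_val_le h hδ (-e)
  -- `cdist e ≤ e.val`, `cdist e ≤ (−e).val`
  have hN1 : (1 : ℝ) ≤ N := by exact_mod_cast Nat.pos_of_ne_zero (NeZero.ne N)
  have hc0 : 0 ≤ (1 - Real.exp (-(δ * N)))⁻¹ := inv_nonneg.mpr (by linarith [Real.exp_lt_one_iff.mpr (show -(δ * (N : ℝ)) < 0 by nlinarith)])
  have hv1 : (cdist e : ℝ) ≤ e.val := by exact_mod_cast cdist_le_val e
  have hv2 : (cdist e : ℝ) ≤ (-e).val := by exact_mod_cast cdist_le_neg_val e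
  have he1 : Real.exp (-(δ * (e.val : ℝ))) ≤ Real.exp (-(δ * (cdist e : ℝ))) := Real.exp_le_exp.mpr (by nlinarith)
  have he2 : Real.exp (-(δ * ((-e).val : ℝ))) ≤ Real.exp (-(δ * (cdist e : ℝ))) := Real.exp_le_exp.mpr (by nlinarith)
  calc ∑ s ∈ Finset.univ.filter (fun s : ZMod N' => ZMod.castHom h (ZMod N) s = e), Real.exp (-(δ * (cdist s : ℝ)))
      ≤ ∑ s ∈ Finset.univ.filter (fun s : ZMod N' => ZMod.castHom h (ZMod N) s = e),
          (Real.exp (-(δ * (s.val : ℝ))) + Real.exp (-(δ * ((-s).val : ℝ)))) := Finset.sum_le_sum fun s _ => hpt s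
    _ ≤ (1 - Real.exp (-(δ * N)))⁻¹ * Real.exp (-(δ * (e.val : ℝ))) + (1 - Real.exp (-(δ * N)))⁻¹ * Real.exp (-(δ * ((-e).val : ℝ))) := by
        rw [Finset.sum_add_distrib]; exact add_le_add hA hB
    _ ≤ (1 - Real.exp (-(δ * N)))⁻¹ * Real.exp (-(δ * (cdist e : ℝ))) + (1 - Real.exp (-(δ * N)))⁻¹ * Real.exp (-(δ * (cdist e : ℝ))) :=
        add_le_add (mul_le_mul_of_nonneg_left he1 hc0) (mul_le_mul_of_nonneg_left he2 hc0)
    _ = 2 * (1 - Real.exp (-(δ * N)))⁻¹ * Real.exp (-(δ * (cdist e : ℝ))) := by ring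

/-- the same with a base point: `Σ_{π t = c} e^{−δ·cdist (a − t)} ≤ 2(1 − e^{−δN})⁻¹ · e^{−δ·cdist (π a − c)}` (re-index `t ↦ a − t`, a bijection of the fibre over `c`
onto the fibre over `π a − c`). [cite: Balaban1984PropagatorsI, (1.110) p.35] -/
theorem sum_fibre_exp_neg_cdist_sub_le [NeZero N] [NeZero N'] (h : N ∣ N') {δ : ℝ} (hδ : 0 < δ) (a : ZMod N') (c : ZMod N) :
    ∑ t ∈ Finset.univ.filter (fun t : ZMod N' => ZMod.castHom h (ZMod N) t = c), Real.exp (-(δ * (cdist (a - t) : ℝ))) ≤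
      2 * (1 - Real.exp (-(δ * N)))⁻¹ * Real.exp (-(δ * (cdist (ZMod.castHom h (ZMod N) a - c) : ℝ))) := by
  have hre : ∑ t ∈ Finset.univ.filter (fun t : ZMod N' => ZMod.castHom h (ZMod N) t = c), Real.exp (-(δ * (cdist (a - t) : ℝ))) =
      ∑ s ∈ Finset.univ.filter (fun s : ZMod N' => ZMod.castHom h (ZMod N) s = ZMod.castHom h (ZMod N) a - c), Real.exp (-(δ * (cdist s : ℝ))) := by
    refine Finset.sum_nbij' (fun t => a - t) (fun s => a - s) ?_ ?_ (fun t _ => sub_sub_cancel a t) (fun s _ => sub_sub_cancel a s) (fun t _ => rfl)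
    · intro t ht
      simp only [Finset.mem_filter, Finset.mem_univ, true_and] at ht ⊢
      rw [map_sub, ht]
    · intro s hs
      simp only [Finset.mem_filter, Finset.mem_univ, true_and] at hs ⊢
      rw [map_sub, hs, sub_sub_cancel]
  rw [hre]
  exact sum_fibre_exp_neg_cdist_le h hδ _

end OneCoordinate

/-! ## §2 Sites of the `L^{jc}`-fold cover: `π` shrinks `|·|₁`, the site fibre is the product of the coordinate fibres, the fibre sum -/

section Sites

variable (P : Params) (jc : ℕ) {i : ℕ}

/-- **`π` CAN ONLY SHRINK THE `ℓ¹` TORUS DISTANCE**: `|π x̃ − π ỹ|₁ ≤ |x̃ − ỹ|₁` (the `ℓ¹` twin of ✓`CoverSites.distSite_proj_le`). [cite: Balaban1984PropagatorsI, (1.110) p.35] -/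
theorem tdist_proj_le (x y : Site (cover P jc) i) : Site.tdist (proj P jc i x) (proj P jc i y) ≤ Site.tdist x y := by
  rw [tdist_eq_sum_cdist, tdist_eq_sum_cdist]
  refine Finset.sum_le_sum fun μ _ => ?_
  rw [proj_apply, proj_apply, ← map_sub]
  exact cdist_castHom_le (sitesPerDir_dvd P jc i) (x μ - y μ)

/-- **THE SITE FIBRE IS THE PRODUCT OF THE COORDINATE FIBRES** (`π` is coordinatewise). [folklore] -/
theorem filter_proj_eq_piFinset (y : Site P i) :
    (Finset.univ.filter fun yt : Site (cover P jc) i => proj P jc i yt = y) =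
      Fintype.piFinset fun μ : Fin P.d =>
        Finset.univ.filter fun t : ZMod ((cover P jc).sitesPerDir i) => ZMod.castHom (sitesPerDir_dvd P jc i) (ZMod (P.sitesPerDir i)) t = y μ := by
  ext yt
  simp only [Finset.mem_filter, Finset.mem_univ, true_and]
  constructor
  · intro hy
    refine Fintype.mem_piFinset.mpr fun μ => ?_
    simp only [Finset.mem_filter, Finset.mem_univ, true_and]
    rw [← hy, proj_apply]
  · intro hy
    funext μ
    have hμ := Fintype.mem_piFinset.mp hy μ
    simp only [Finset.mem_filter, Finset.mem_univ, true_and] at hμ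
    rw [proj_apply]
    exact hμ

/-- ★★ **THE BRICK — KERNEL DECAY DESCENDS ALONG THE COVER WITH NO LOSS OF RATE**: for every `δ > 0`, every lift `x̃` and every site `y` downstairs,
`Σ_{π ỹ = y} e^{−δ·|x̃ − ỹ|₁} ≤ (2(1 − e^{−δ·N_i})⁻¹)^d · e^{−δ·|π x̃ − y|₁}`, `N_i = 2L^{m+K−i}` the member's site count per direction (`e^{−δΣ_μ} = Π_μ e^{−δ·}`, the
fibre is the product of the coordinate fibres, `Finset.prod_univ_sum`, and §1 in each coordinate). [cite: Balaban1985BackgroundPropagators, Thm 3.2 p.398–399 («the constants … do not depend on the sequence {Ω_j}», p.399 L1–3)] -/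
theorem sum_fibre_exp_neg_tdist_le {δ : ℝ} (hδ : 0 < δ) (xt : Site (cover P jc) i) (y : Site P i) :
    ∑ yt ∈ Finset.univ.filter (fun yt : Site (cover P jc) i => proj P jc i yt = y), Real.exp (-(δ * (Site.tdist xt yt : ℝ))) ≤
      (2 * (1 - Real.exp (-(δ * P.sitesPerDir i)))⁻¹) ^ P.d * Real.exp (-(δ * (Site.tdist (proj P jc i xt) y : ℝ))) := by
  -- the summand factorises over the coordinates
  have hfac : ∀ yt : Site (cover P jc) i, Real.exp (-(δ * (Site.tdist xt yt : ℝ))) =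
      ∏ μ : Fin P.d, Real.exp (-(δ * (cdist (xt μ - yt μ) : ℝ))) := by
    intro yt
    rw [tdist_eq_sum_cdist, Nat.cast_sum, Finset.mul_sum, ← Finset.sum_neg_distrib, Real.exp_sum]
  -- the fibre sum is the product of the coordinate fibre sums
  have hprod : ∑ yt ∈ Finset.univ.filter (fun yt : Site (cover P jc) i => proj P jc i yt = y), Real.exp (-(δ * (Site.tdist xt yt : ℝ))) =
      ∏ μ : Fin P.d, ∑ t ∈ Finset.univ.filter (fun t : ZMod ((cover P jc).sitesPerDir i) =>
          ZMod.castHom (sitesPerDir_dvd P jc i) (ZMod (P.sitesPerDir i)) t = y μ), Real.exp (-(δ * (cdist (xt μ - t) : ℝ))) := by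
    rw [Finset.prod_univ_sum, filter_proj_eq_piFinset P jc y]
    exact Finset.sum_congr rfl fun yt _ => hfac yt
  -- each coordinate fibre sum is bounded by §1
  have hco : ∀ μ : Fin P.d, ∑ t ∈ Finset.univ.filter (fun t : ZMod ((cover P jc).sitesPerDir i) =>
        ZMod.castHom (sitesPerDir_dvd P jc i) (ZMod (P.sitesPerDir i)) t = y μ), Real.exp (-(δ * (cdist (xt μ - t) : ℝ))) ≤
      2 * (1 - Real.exp (-(δ * P.sitesPerDir i)))⁻¹ * Real.exp (-(δ * (cdist (proj P jc i xt μ - y μ) : ℝ))) := by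
    intro μ
    rw [proj_apply]
    exact sum_fibre_exp_neg_cdist_sub_le (sitesPerDir_dvd P jc i) hδ (xt μ) (y μ)
  have hnn : ∀ μ : Fin P.d, 0 ≤ ∑ t ∈ Finset.univ.filter (fun t : ZMod ((cover P jc).sitesPerDir i) =>
        ZMod.castHom (sitesPerDir_dvd P jc i) (ZMod (P.sitesPerDir i)) t = y μ), Real.exp (-(δ * (cdist (xt μ - t) : ℝ))) :=
    fun μ => Finset.sum_nonneg fun t _ => (Real.exp_pos _).le
  rw [hprod]
  calc ∏ μ : Fin P.d, ∑ t ∈ Finset.univ.filter (fun t : ZMod ((cover P jc).sitesPerDir i) =>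
          ZMod.castHom (sitesPerDir_dvd P jc i) (ZMod (P.sitesPerDir i)) t = y μ), Real.exp (-(δ * (cdist (xt μ - t) : ℝ)))
      ≤ ∏ μ : Fin P.d, (2 * (1 - Real.exp (-(δ * P.sitesPerDir i)))⁻¹ * Real.exp (-(δ * (cdist (proj P jc i xt μ - y μ) : ℝ)))) :=
        Finset.prod_le_prod (fun μ _ => hnn μ) fun μ _ => hco μ
    _ = (2 * (1 - Real.exp (-(δ * P.sitesPerDir i)))⁻¹) ^ P.d * Real.exp (-(δ * (Site.tdist (proj P jc i xt) y : ℝ))) := by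
        rw [Finset.prod_mul_distrib, Finset.prod_const, Finset.card_univ, Fintype.card_fin, tdist_eq_sum_cdist, Nat.cast_sum, Finset.mul_sum,
          ← Finset.sum_neg_distrib, Real.exp_sum]

/-- the fibre constant is MEMBER-FREE: `2(1 − e^{−δN_i})⁻¹ ≤ 2(1 − e^{−2δ})⁻¹ since every torus of the series has `N_i = 2L^{m+K−i} ≥ 2` sites per direction
(the tree's ✓`BIJ85LineSumReflection.two_le_sitesPerDir`, re-derived inline to keep the import cone inside the Bałaban series). [cite: Balaban1987RG1, (0.1) p.251] -/
theorem fibreConst_le {δ : ℝ} (hδ : 0 < δ) (i : ℕ) :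
    2 * (1 - Real.exp (-(δ * P.sitesPerDir i)))⁻¹ ≤ 2 * (1 - Real.exp (-(2 * δ)))⁻¹ := by
  have h1 : 1 ≤ P.L ^ (P.m + P.K - i) := Nat.one_le_pow _ _ P.L_pos
  have h2 : (2 : ℝ) ≤ P.sitesPerDir i := by exact_mod_cast (show 2 ≤ P.sitesPerDir i by unfold Params.sitesPerDir; omega)
  have hlt : Real.exp (-(2 * δ)) < 1 := Real.exp_lt_one_iff.mpr (by linarith)
  have hle : Real.exp (-(δ * P.sitesPerDir i)) ≤ Real.exp (-(2 * δ)) := Real.exp_le_exp.mpr (by nlinarith)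
  have hpos : 0 < 1 - Real.exp (-(2 * δ)) := by linarith
  exact mul_le_mul_of_nonneg_left (inv_anti₀ hpos (by linarith)) zero_le_two

/-- `0 ≤ 2(1 − e^{−δN_i})⁻¹`. [folklore] -/
theorem fibreConst_nonneg {δ : ℝ} (hδ : 0 < δ) (i : ℕ) : 0 ≤ 2 * (1 - Real.exp (-(δ * P.sitesPerDir i)))⁻¹ := by
  have h1 : 1 ≤ P.L ^ (P.m + P.K - i) := Nat.one_le_pow _ _ P.L_pos
  have h2 : (2 : ℝ) ≤ P.sitesPerDir i := by exact_mod_cast (show 2 ≤ P.sitesPerDir i by unfold Params.sitesPerDir; omega)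
  have hlt : Real.exp (-(δ * P.sitesPerDir i)) < 1 := Real.exp_lt_one_iff.mpr (by nlinarith)
  exact mul_nonneg zero_le_two (inv_nonneg.mpr (by linarith))

/-- ★★ **THE BRICK WITH A MEMBER-FREE CONSTANT**: `Σ_{π ỹ = y} e^{−δ·|x̃ − ỹ|₁} ≤ (2(1 − e^{−2δ})⁻¹)^d · e^{−δ·|π x̃ − y|₁}` — a function of `δ` and `d` ONLY, for every
member (volume exponent `m`), every cover degree `jc`, every level `i` and every number of steps `K` (fits the ∃-cap supplier shape of the EX face's print rows).
[cite: Balaban1985BackgroundPropagators, Thm 3.2 p.398–399 (p.399 L1–3)] -/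
theorem sum_fibre_exp_neg_tdist_le' {δ : ℝ} (hδ : 0 < δ) (xt : Site (cover P jc) i) (y : Site P i) :
    ∑ yt ∈ Finset.univ.filter (fun yt : Site (cover P jc) i => proj P jc i yt = y), Real.exp (-(δ * (Site.tdist xt yt : ℝ))) ≤
      (2 * (1 - Real.exp (-(2 * δ)))⁻¹) ^ P.d * Real.exp (-(δ * (Site.tdist (proj P jc i xt) y : ℝ))) := by
  refine (sum_fibre_exp_neg_tdist_le P jc hδ xt y).trans (mul_le_mul_of_nonneg_right ?_ (Real.exp_pos _).le)
  exact pow_le_pow_left₀ (fibreConst_nonneg P hδ i) (fibreConst_le P hδ i) P.d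

end Sites

/-! ## §3 Kernels: the push-forward of an exponentially decaying cover kernel decays downstairs at the same rate -/

section Kernels

variable (P : Params) (jc : ℕ) {i : ℕ} {E : Type*} [SeminormedAddCommGroup E]

/-- ★★ **KERNEL ROWS DESCEND**: if a cover kernel column satisfies `‖g ỹ‖ ≤ C·e^{−δ·|x̃ − ỹ|₁}` for all `ỹ`, then its push-forward (`(π_* g)(y) = Σ_{π ỹ = y} g ỹ`,
✓`CoverSites.push`) satisfies `‖(π_* g)(y)‖ ≤ C·(2(1 − e^{−2δ})⁻¹)^d·e^{−δ·|π x̃ − y|₁}` — same rate, constant a function of `δ, d` only.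
[cite: Balaban1985BackgroundPropagators, Thm 3.2 p.398–399 (p.399 L1–3); Balaban1984PropagatorsI, (1.110) p.35] -/
theorem norm_push_le_of_kernel_decay {C δ : ℝ} (hδ : 0 < δ) (xt : Site (cover P jc) i) (g : Site (cover P jc) i → E)
    (hg : ∀ yt : Site (cover P jc) i, ‖g yt‖ ≤ C * Real.exp (-(δ * (Site.tdist xt yt : ℝ)))) (y : Site P i) :
    ‖push P jc i g y‖ ≤ C * (2 * (1 - Real.exp (-(2 * δ)))⁻¹) ^ P.d * Real.exp (-(δ * (Site.tdist (proj P jc i xt) y : ℝ))) := by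
  -- `C ≥ 0` unless the fibre is irrelevant: from `hg` at `xt` itself, `0 ≤ ‖g xt‖ ≤ C·e^0`
  have hC : 0 ≤ C := by
    have h0 := (norm_nonneg (g xt)).trans (hg xt)
    have hz : Site.tdist xt xt = 0 := by simp [Site.tdist]
    rw [hz, Nat.cast_zero, mul_zero, neg_zero, Real.exp_zero, mul_one] at h0
    exact h0
  rw [push_apply]
  calc ‖∑ yt ∈ Finset.univ.filter (fun yt : Site (cover P jc) i => proj P jc i yt = y), g yt‖
      ≤ ∑ yt ∈ Finset.univ.filter (fun yt : Site (cover P jc) i => proj P jc i yt = y), ‖g yt‖ := norm_sum_le _ _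
    _ ≤ ∑ yt ∈ Finset.univ.filter (fun yt : Site (cover P jc) i => proj P jc i yt = y), C * Real.exp (-(δ * (Site.tdist xt yt : ℝ))) :=
        Finset.sum_le_sum fun yt _ => hg yt
    _ = C * ∑ yt ∈ Finset.univ.filter (fun yt : Site (cover P jc) i => proj P jc i yt = y), Real.exp (-(δ * (Site.tdist xt yt : ℝ))) := by
        rw [Finset.mul_sum]
    _ ≤ C * ((2 * (1 - Real.exp (-(2 * δ)))⁻¹) ^ P.d * Real.exp (-(δ * (Site.tdist (proj P jc i xt) y : ℝ)))) :=
        mul_le_mul_of_nonneg_left (sum_fibre_exp_neg_tdist_le' P jc hδ xt y) hC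
    _ = C * (2 * (1 - Real.exp (-(2 * δ)))⁻¹) ^ P.d * Real.exp (-(δ * (Site.tdist (proj P jc i xt) y : ℝ))) := by ring

/-- the bond fibre sum of a SOURCE-indexed weight is the site fibre sum at the source (the direction is carried along by `projBond`); the `Finset.filter` form, at `π = proj`, of the subtype-sum identity ✓`CoverAverages.sum_bondFibre_eq` (general level map `φ`). [folklore] -/
theorem sum_bondFibre_eq_sum_siteFibre [DecidableEq (PBond P i)] (f : Site (cover P jc) i → ℝ) (b : PBond P i) :
    ∑ bt ∈ Finset.univ.filter (fun bt : PBond (cover P jc) i => projBond P jc i bt = b), f bt.src =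
      ∑ yt ∈ Finset.univ.filter (fun yt : Site (cover P jc) i => proj P jc i yt = b.src), f yt := by
  refine Finset.sum_nbij' (fun bt => bt.src) (fun yt => ⟨yt, b.dir⟩) ?_ ?_ ?_ (fun yt _ => rfl) (fun bt _ => rfl)
  · intro bt hbt
    simp only [Finset.mem_filter, Finset.mem_univ, true_and] at hbt ⊢
    rw [← hbt, projBond_src]
  · intro yt hyt
    simp only [Finset.mem_filter, Finset.mem_univ, true_and] at hyt ⊢
    cases b with
    | mk src dir => simp only at hyt; rw [projBond, hyt]
  · intro bt hbt
    simp only [Finset.mem_filter, Finset.mem_univ, true_and] at hbt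
    cases bt with
    | mk src dir => rw [show dir = b.dir by rw [← hbt, projBond_dir]]

/-- **BOND-INDEXED FORM** (the EX face's kernel rows are indexed by bonds and measured at their sources): if `‖g b̃‖ ≤ C·e^{−δ·|x̃ − b̃.src|₁}` on the cover bonds, then
`‖(π_* g)(b)‖ ≤ C·(2(1 − e^{−2δ})⁻¹)^d·e^{−δ·|π x̃ − b.src|₁}` (`CoverSites.pushBond`). [cite: Balaban1985BackgroundPropagators, Thm 3.2 p.398–399 (p.399 L1–3)] -/
theorem norm_pushBond_le_of_kernel_decay [DecidableEq (PBond P i)] {C δ : ℝ} (hδ : 0 < δ) (xt : Site (cover P jc) i) (g : PBond (cover P jc) i → E)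
    (hg : ∀ bt : PBond (cover P jc) i, ‖g bt‖ ≤ C * Real.exp (-(δ * (Site.tdist xt bt.src : ℝ)))) (b : PBond P i) :
    ‖pushBond P jc i g b‖ ≤ C * (2 * (1 - Real.exp (-(2 * δ)))⁻¹) ^ P.d * Real.exp (-(δ * (Site.tdist (proj P jc i xt) b.src : ℝ))) := by
  have hd1 : 1 ≤ P.d := P.hd
  have hC : 0 ≤ C := by
    have h0 := (norm_nonneg (g ⟨xt, ⟨0, hd1⟩⟩)).trans (hg ⟨xt, ⟨0, hd1⟩⟩)
    have hz : Site.tdist xt xt = 0 := by simp [Site.tdist]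
    simp only [hz, Nat.cast_zero, mul_zero, neg_zero, Real.exp_zero, mul_one] at h0
    exact h0
  rw [pushBond_apply]
  calc ‖∑ bt ∈ Finset.univ.filter (fun bt : PBond (cover P jc) i => projBond P jc i bt = b), g bt‖
      ≤ ∑ bt ∈ Finset.univ.filter (fun bt : PBond (cover P jc) i => projBond P jc i bt = b), ‖g bt‖ := norm_sum_le _ _
    _ ≤ ∑ bt ∈ Finset.univ.filter (fun bt : PBond (cover P jc) i => projBond P jc i bt = b), C * Real.exp (-(δ * (Site.tdist xt bt.src : ℝ))) :=
        Finset.sum_le_sum fun bt _ => hg bt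
    _ = C * ∑ yt ∈ Finset.univ.filter (fun yt : Site (cover P jc) i => proj P jc i yt = b.src), Real.exp (-(δ * (Site.tdist xt yt : ℝ))) := by
        rw [← Finset.mul_sum]
        congr 1
        exact sum_bondFibre_eq_sum_siteFibre P jc (fun yt => Real.exp (-(δ * (Site.tdist xt yt : ℝ)))) b
    _ ≤ C * ((2 * (1 - Real.exp (-(2 * δ)))⁻¹) ^ P.d * Real.exp (-(δ * (Site.tdist (proj P jc i xt) b.src : ℝ)))) :=
        mul_le_mul_of_nonneg_left (sum_fibre_exp_neg_tdist_le' P jc hδ xt b.src) hC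
    _ = C * (2 * (1 - Real.exp (-(2 * δ)))⁻¹) ^ P.d * Real.exp (-(δ * (Site.tdist (proj P jc i xt) b.src : ℝ))) := by ring

end Kernels

/-! ## §4 Point sources: the pullback of a point source is the fibre sum of point sources -/

section PointSources

variable (P : Params) (jc : ℕ) {i : ℕ} {M : Type*} [AddCommMonoid M]

/-- **`(single y Z) ∘ π = Σ_{π ỹ = y} single ỹ Z`** on sites: at `x̃` both sides are `Z` if `π x̃ = y` and `0` otherwise (exactly one element of the fibre equals `x̃` iff
`π x̃ = y`). [folklore] -/
theorem single_comp_proj [DecidableEq (Site P i)] [DecidableEq (Site (cover P jc) i)] (y : Site P i) (Z : M) :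
    (Pi.single y Z : Site P i → M) ∘ proj P jc i = ∑ yt ∈ Finset.univ.filter (fun yt : Site (cover P jc) i => proj P jc i yt = y), (Pi.single yt Z : Site (cover P jc) i → M) := by
  funext xt
  rw [Function.comp_apply, Finset.sum_apply, Finset.sum_pi_single xt (fun _ => Z), Pi.single_apply]
  simp only [Finset.mem_filter, Finset.mem_univ, true_and]

/-- the bond form: `(single b Z) ∘ π = Σ_{π b̃ = b} single b̃ Z` (`π = projBond`, direction carried along). [folklore] -/
theorem single_comp_projBond [DecidableEq (PBond P i)] [DecidableEq (PBond (cover P jc) i)] (b : PBond P i) (Z : M) :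
    (Pi.single b Z : PBond P i → M) ∘ projBond P jc i = ∑ bt ∈ Finset.univ.filter (fun bt : PBond (cover P jc) i => projBond P jc i bt = b), (Pi.single bt Z : PBond (cover P jc) i → M) := by
  funext ct
  rw [Function.comp_apply, Finset.sum_apply, Finset.sum_pi_single ct (fun _ => Z), Pi.single_apply]
  simp only [Finset.mem_filter, Finset.mem_univ, true_and]

end PointSources

end Summit.QuantumFields.YangMills.Theorems.CoverKernelFibreSum
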